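import Mathlib
import HarnessLib

/-!
# Good reduction of the ambient is unchanged where a modification is an isomorphism

Stub `stub_goodAtOverIso` of the line `strata-split` for the crux `EquisingularLift`
(stmt-ResolutionOfSingularities-15660).

If `σ₂ : P₂ ⟶ P₁` restricts to an isomorphism over an open `V ⊆ P₁` and `σ₂ y = x₁ ∈ V`, then the
stalk map `𝒪_{P₁,x₁} ⟶ 𝒪_{P₂,y}` is an isomorphism of local rings, compatible with germs of global
sections. Hence `𝒪_{P₂,y}` is regular iff `𝒪_{P₁,x₁}` is, and for a structure map
`r₁ : P₁ ⟶ Spec O` and `ϖ : O`, the germ at `y` of `ϖ` pulled back along `σ₂ ≫ r₁` lies outside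
`𝔪_y²` iff the germ at `x₁` of `ϖ` pulled back along `r₁` lies outside `𝔪_{x₁}²`.

Reference: U. Görtz, T. Wedhorn, *Algebraic Geometry I*, 2nd ed. (2020), Prop. 13.91 (3)
(local rings do not change where a morphism restricts to an isomorphism). [GortzWedhorn2020]
-/

set_option linter.dupNamespace false -- mandated namespace of this single-conjunct summit

namespace Summit.ResolutionOfSingularities.ResolutionOfSingularities.Cruxes.EquisingularLift.StrataSplit

open CategoryTheory AlgebraicGeometry TopologicalSpace

/-- If `π : X' ⟶ X` restricts to an isomorphism over an open `U ⊆ X` and `π x ∈ U`, then the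
stalk map `𝒪_{X, π x} ⟶ 𝒪_{X', x}` is an isomorphism (the stalk maps of `π ∣_ U` and of `π` at
`x` are isomorphic arrows, `AlgebraicGeometry.morphismRestrictStalkMap`). -/
private theorem isIso_stalkMap_of_isIso_morphismRestrict {X' X : Scheme.{0}} (π : X' ⟶ X)
    (U : X.Opens) [IsIso (π ∣_ U)] (x : X') (hx : π x ∈ U) : IsIso (π.stalkMap x) := by
  -- adapted from Literature/AlgebraicGeometry/Resolution/BlowupsFlatBaseChange.lean
  have h1 : IsIso ((π ∣_ U).stalkMap ⟨x, hx⟩) := inferInstance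
  have h2 := (Arrow.isIso_iff_isIso_of_isIso (morphismRestrictStalkMap π U ⟨x, hx⟩).hom).mp h1
  simpa using h2

/-- The stalk map `𝒪_{P₁, σ₂ y} ⟶ 𝒪_{P₂, y}` sends the germ at `σ₂ y` of a global section `s`
to the germ at `y` of the pulled-back global section `σ₂.appTop s`. -/
private theorem stalkMap_Γgerm_apply {P₁ P₂ : Scheme.{0}} (σ₂ : P₂ ⟶ P₁) (y : P₂) (s : Γ(P₁, ⊤)) :
    (σ₂.stalkMap y).hom ((P₁.presheaf.Γgerm (σ₂ y)).hom s) =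
      (P₂.presheaf.Γgerm y).hom (σ₂.appTop.hom s) := by
  simp only [TopCat.Presheaf.Γgerm]
  rw [Scheme.Hom.germ_stalkMap_apply]
  rfl

/-- **`stub_goodAtOverIso` (structural).** If `σ₂ : P₂ → P₁` is an isomorphism over the open
`V ⊆ P₁` and `σ₂ y = x₁ ∈ V`, then the stalk map `𝒪_{P₁,x₁} → 𝒪_{P₂,y}` is an isomorphism
compatible with germs of global sections, so: `𝒪_{P₂,y}` is regular iff `𝒪_{P₁,x₁}` is, and
for any `r₁ : P₁ → Spec O` and `ϖ : O` the germ of `ϖ` pulled back along `σ₂ ≫ r₁` lies outside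
`𝔪_y²` iff the germ of `ϖ` pulled back along `r₁` lies outside `𝔪_{x₁}²` (stated as the
equivalence of the two `GoodAt` conjunctions, unfolded). [GortzWedhorn2020, Prop. 13.91 (3)] -/
theorem stub_goodAtOverIso : ∀ (P₁ P₂ : AlgebraicGeometry.Scheme.{0}) (σ₂ : P₂ ⟶ P₁) (V : P₁.Opens),
    CategoryTheory.IsIso (σ₂ ∣_ V) → ∀ (y : P₂) (x₁ : P₁), σ₂ y = x₁ → x₁ ∈ V →
    ∀ (O : Type) [CommRing O] (r₁ : P₁ ⟶ AlgebraicGeometry.Spec (.of O)),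
    (IsRegularLocalRing (P₂.presheaf.stalk y) ∧
      ∀ ϖ : O, Irreducible ϖ → (P₂.presheaf.Γgerm y).hom
        ((CategoryTheory.CategoryStruct.comp σ₂ r₁).appTop.hom
          ((AlgebraicGeometry.Scheme.ΓSpecIso (CommRingCat.of O)).inv.hom ϖ)) ∉
        (IsLocalRing.maximalIdeal (P₂.presheaf.stalk y)) ^ 2) ↔
    (IsRegularLocalRing (P₁.presheaf.stalk x₁) ∧
      ∀ ϖ : O, Irreducible ϖ → (P₁.presheaf.Γgerm x₁).hom
        (r₁.appTop.hom ((AlgebraicGeometry.Scheme.ΓSpecIso (CommRingCat.of O)).inv.hom ϖ)) ∉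
        (IsLocalRing.maximalIdeal (P₁.presheaf.stalk x₁)) ^ 2) := by
  intro P₁ P₂ σ₂ V hiso y x₁ hyx hxV O _ r₁
  subst hyx
  haveI : IsIso (σ₂.stalkMap y) := isIso_stalkMap_of_isIso_morphismRestrict σ₂ V y hxV
  -- the local isomorphism `𝒪_{P₁, σ₂ y} ≃+* 𝒪_{P₂, y}`
  let e : P₁.presheaf.stalk (σ₂ y) ≃+* P₂.presheaf.stalk y :=
    (asIso (σ₂.stalkMap y)).commRingCatIsoToRingEquiv
  -- it maps `𝔪²` onto `𝔪²`
  have key : ∀ a : P₁.presheaf.stalk (σ₂ y),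
      e a ∈ IsLocalRing.maximalIdeal (P₂.presheaf.stalk y) ^ 2 ↔
        a ∈ IsLocalRing.maximalIdeal (P₁.presheaf.stalk (σ₂ y)) ^ 2 := fun a => by
    rw [← IsLocalRing.map_ringEquiv_maximalIdeal e, ← Ideal.map_pow, Ideal.apply_mem_of_equiv_iff]
  -- and it is compatible with germs of global sections
  have germ_eq : ∀ s : Γ(Spec (CommRingCat.of O), ⊤),
      (P₂.presheaf.Γgerm y).hom ((σ₂ ≫ r₁).appTop.hom s) =
        e ((P₁.presheaf.Γgerm (σ₂ y)).hom (r₁.appTop.hom s)) := fun s =>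
    (stalkMap_Γgerm_apply σ₂ y (r₁.appTop.hom s)).symm
  refine and_congr ⟨fun _ => IsRegularLocalRing.of_ringEquiv e.symm,
    fun _ => IsRegularLocalRing.of_ringEquiv e⟩ (forall_congr' fun ϖ => ?_)
  refine imp_congr_right fun _ => ?_
  rw [germ_eq, key]

end Summit.ResolutionOfSingularities.ResolutionOfSingularities.Cruxes.EquisingularLift.StrataSplit
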